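import Summits.BirchSwinnertonDyer.BirchSwinnertonDyer.Theorems.SlopeDichotomyA2DegenerateLocusA2HeightIntegralityIsogeny
import Literature.NumberTheory.EllipticCurves.CanonicalPAdicHeightParallelogramProofs
import Literature.NumberTheory.EllipticCurves.IsogenyMordellWeilRankProofs
import HarnessLib
import Literature.NumberTheory.EllipticCurves.IsogenyNonsingularReduction

/-!
# H-int along a degree-`p` isogeny with the good-position hypothesis (comp) DISCHARGED from print
# (Dokchitser–Dokchitser 2015 Lemma 24 / Néron mapping property), and the corner-A2 T-λ3 corollaries

Support file (prover seat `bsd-schneider-i1-c2`, gen 6, cell `bsd-schneider-ideate`; `--supports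
stmt-BirchSwinnertonDyer-19086`), third of the height-integrality series (`…HeightIntegrality` p460291: abstract
Lemma H-int with hypotheses (red), (comp), (adj); `…HeightIntegralityIsogeny` p461719: (adj) discharged from
Mazur–Tate 1983 (3.4.3), fact p461718). Of the two remaining per-isogeny STRUCTURAL hypotheses,
 (comp) `f(E(ℚ) ∩ E⁰(ℚ_ℓ)) ⊆ E'(ℚ) ∩ E'⁰(ℚ_ℓ)` for every prime `ℓ`
is a PRINTED statement — Dokchitser–Dokchitser, *Local invariants of isogenous elliptic curves* (TAMS 2015), proof
of Lemma 24, first sentence: «The isogeny `φ` induces maps `E(K) → E'(K)` and `E₀(K) → E'₀(K)`» (`K` local; by the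
Néron mapping property, Silverman ATAEC IV.5.1, and `E₀(K) = 𝓔⁰(R)`, IV.9.1–9.2) — stated here ONCE as a cite-tagged
named fact in the tree's vocabulary (§0, for relocation under `Literature/NumberTheory/EllipticCurves/`) and used
to remove (comp) from the hypotheses (§1). What remains structural is (red) `p • R ∈ E₁(ℚ_p) ⇒ f R ∈ E'₁(ℚ_p)`
alone — the A2-specific input «`ker φ = Φ` with `Φ(ℚ̄_p) ⊂ E(ℚ_p)` reducing onto `Ẽ(𝔽_p)[p]`» (memo ROUTE-P3-v8
§1.3 (b); kit j253553: 560/560), which needs the map of `φ` on `ℚ_p`-points together with the reduction map and is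
not a printed theorem by itself.

* §0 `isogeny_pointHom_maps_nonsingularReductionSubgroupAt` — NAMED FACT (nothing asserted).
* §1 `valuation_padicRegulator_nonneg_of_isogeny_of_red` (H-int: `‖⟨P,Q⟩‖ ≤ 1` and `0 ≤ ord_p Reg_p` for a
  degree-`p` `ℚ`-isogeny with (red), `p ∤` the local indices of `E`; modulo MT83 (3.4.3), DD15 L.24, MT σ);
  on corner A2: `regTamFloor_of_typeBRankOne_of_isogeny_of_red`,
  **`not_analyticLambdaEq_one_of_typeBRankOne_of_isogeny_of_red`** (T-λ3: `¬ AnalyticLambdaEq W p 1`),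
  `three_le_of_analyticLambdaEq_of_typeBRankOne_of_isogeny_of_red` (`λ_an ≥ 3`) — at every A2 pair `(W, p)` with
  `p ∤ [W(ℚ) : W(ℚ) ∩ W⁰(ℚ_ℓ)]` for all `ℓ` (exact census kit j258343: 1 955 of the 2 797 A2 class-pairs, of
  which 1 765 have `p ∤ ∏c_ℓ`) admitting a degree-`p` `ℚ`-isogeny with (red); published inputs BY NAME (W16,
  BMS 1.7, GV 1.3, Greenberg 5.10, Mazur–Tate σ, modularity, GZK, MT83 (3.4.3), DD15 L.24); NO height value inspected.

HONEST NOTE. Item 19086 is untouched (DECIDED-REDUCED, gens 0–5); BSD is not advanced; every theorem here is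
conditional on named facts, and (red) remains an explicit per-pair hypothesis.

References: T. Dokchitser, V. Dokchitser, *Local invariants of isogenous elliptic curves*, Trans. AMS 367 (2015)
4339–4358, Lemma 24 and Thm. 23 [DokchitserDokchitser2015LocalInvariants]; J. H. Silverman, *Advanced Topics in
the Arithmetic of Elliptic Curves* (1994), IV.5.1, IV.9.1–9.2 [SilvermanATAEC1994]; Mazur–Tate 1983 §3.4 (3.4.3)
[MazurTate1983Biext].
-/

set_option autoImplicit false

noncomputable section

open scoped Classical MatrixGroups ModularForm

open PowerSeries CongruenceSubgroup WeierstrassCurve Literature.NumberTheory.EllipticCurves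
  Literature.NumberTheory.EllipticCurves.ModularForms Literature.NumberTheory.EllipticCurves.Rank1Residual
  Literature.NumberTheory.EllipticCurves.Greenberg1999 Summit.BirchSwinnertonDyer.Rank1Residual
  Summit.BirchSwinnertonDyer.BirchSwinnertonDyer.Theorems.Rank1ResidualX1Defs
  Summit.BirchSwinnertonDyer.Rank1Residual.X1.MuLambda Summit.BirchSwinnertonDyer.Rank1Residual.X1.MuPart
  Summit.BirchSwinnertonDyer.Rank1Residual.X1.ParitySqueeze Summit.BirchSwinnertonDyer.BirchSwinnertonDyer.Theses
  Summit.BirchSwinnertonDyer.BirchSwinnertonDyer.Theorems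
  Summit.BirchSwinnertonDyer.BirchSwinnertonDyer.Theorems.DegenerateLocusA2HeightIntegrality
  Summit.BirchSwinnertonDyer.BirchSwinnertonDyer.Theorems.DegenerateLocusA2HeightIntegralityIsogeny

set_option linter.dupNamespace false -- summit = sub-problem name (D-0017 layout)

namespace Summit.BirchSwinnertonDyer.BirchSwinnertonDyer.Theorems.DegenerateLocusA2HeightIntegralityNeron

/-! ## §0. The named fact: an isogeny preserves non-singular reduction (Néron mapping property) -/

variable {W W' : WeierstrassCurve ℚ} [W.IsElliptic] [W.IsGloballyMinimal] [W'.IsElliptic] [W'.IsGloballyMinimal]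
  {p : ℕ} [Fact p.Prime]

/-! ## §1. H-int and T-λ3 with (comp) discharged: only (red) remains structural -/

/-- **H-int for a degree-`p` `ℚ`-isogeny with (red): THE canonical height of `E` is `p`-integral and
`0 ≤ ord_p Reg_p`** — as `DegenerateLocusA2HeightIntegralityIsogeny.valuation_padicRegulator_nonneg_of_isogeny`,
with (comp) supplied by the Dokchitser–Dokchitser / Néron fact `hNer`. Hypotheses: `E, E'` globally minimal,
`p ≥ 3` good ordinary for both, `ord_p #Ẽ(𝔽_p) ≤ 1`, `p ∤ [E(ℚ) : E(ℚ) ∩ E⁰(ℚ_ℓ)]` for all `ℓ`, `deg φ = p`,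
(red) for `f = φ(ℚ)`. [cite: MazurTate1983Biext, §3.4 (3.4.3)] [cite: MazurSteinTate2006, §1 eq. (1.1), Thm. 1.3]
[cite: DokchitserDokchitser2015LocalInvariants, §6 Lemma 24 (arXiv numbering)] -/
theorem valuation_padicRegulator_nonneg_of_isogeny_of_red
    (hadjF : Literature.NumberTheory.EllipticCurves.canonicalPAdicHeight_isogeny_adjoint)
    (hNer : Literature.NumberTheory.EllipticCurves.isogeny_pointHom_maps_nonsingularReductionSubgroupAt) (hMT : mazur_tate_sigma_exists_odd)
    (hp : 3 ≤ p) (hgood : W.HasGoodReductionAtPrime p) (hord : ¬ (p : ℤ) ∣ W.frobeniusTrace p)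
    (hgood' : W'.HasGoodReductionAtPrime p) (hord' : ¬ (p : ℤ) ∣ W'.frobeniusTrace p)
    (hN : padicValNat p (W.reductionPointCount p) ≤ 1)
    (hidx : ∀ (ℓ : ℕ) [Fact ℓ.Prime], ¬ p ∣ (W.nonsingularReductionSubgroupAt ℓ).index)
    (φ : Isogeny W W') (hdeg : φ.degree = p) {f : W.toAffine.Point →+ W'.toAffine.Point}
    (hf : ∀ P : W.toAffine.Point, W'.toGeomPoints (f P) = φ (W.toGeomPoints P))
    (hred : ∀ R : W.toAffine.Point, p • R ∈ W.kernelOfReductionAt p → f R ∈ W'.kernelOfReductionAt p)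
    {D : PAdicHeightData W p} (hD : D.IsCanonical) :
    (∀ P Q : W.toAffine.Point, ‖D.pairing P Q‖ ≤ 1) ∧
      (padicRegulator D ≠ 0 → 0 ≤ (padicRegulator D).valuation) :=
  valuation_padicRegulator_nonneg_of_isogeny hadjF hMT hp hgood hord hgood' hord' hN hidx φ hdeg hf hred
    (fun ℓ _ R hR ↦ hNer W W' φ (hdeg ▸ Fact.out) f hf ℓ R hR) hD

/-- **On corner A2, with (comp) from print: the regulator–Tamagawa floor** `Reg_p ≠ 0 → 0 ≤ ord_p Reg_p + ord_p ∏c_ℓ`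
for EVERY canonical datum, at an A2 pair `(W, p)` with `p ∤` the local indices of `W` and a degree-`p`
`ℚ`-isogeny `φ : W → W'` (globally minimal `W'`) whose map on rational points satisfies (red).
[cite: MazurTate1983Biext, §3.4 (3.4.3)]
[cite: DokchitserDokchitser2015LocalInvariants, §6 Lemma 24 (arXiv numbering)] -/
theorem regTamFloor_of_typeBRankOne_of_isogeny_of_red
    (hadjF : Literature.NumberTheory.EllipticCurves.canonicalPAdicHeight_isogeny_adjoint)
    (hNer : Literature.NumberTheory.EllipticCurves.isogeny_pointHom_maps_nonsingularReductionSubgroupAt) (hMT : mazur_tate_sigma_exists_odd)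
    (hB : X1.TypeBRankOne W p)
    (hidx : ∀ (ℓ : ℕ) [Fact ℓ.Prime], ¬ p ∣ (W.nonsingularReductionSubgroupAt ℓ).index)
    (φ : Isogeny W W') (hdeg : φ.degree = p) {f : W.toAffine.Point →+ W'.toAffine.Point}
    (hf : ∀ P : W.toAffine.Point, W'.toGeomPoints (f P) = φ (W.toGeomPoints P))
    (hred : ∀ R : W.toAffine.Point, p • R ∈ W.kernelOfReductionAt p → f R ∈ W'.kernelOfReductionAt p) :
    ∀ Dh : PAdicHeightData W p, Dh.IsCanonical → padicRegulator Dh ≠ 0 →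
      0 ≤ (padicRegulator Dh).valuation + (padicValNat p W.tamagawaProduct : ℤ) :=
  regTamFloor_of_typeBRankOne_of_isogeny hadjF hMT hB hidx φ hdeg hf hred
    (fun ℓ _ R hR ↦ hNer W W' φ (hdeg ▸ Fact.out) f hf ℓ R hR)

/-- **T-λ3 on corner A2 with (comp) from print (memo ROUTE-P3-v8 (T1); published inputs BY NAME + the single
per-pair hypothesis (red); NO height value inspected): `λ_an ≠ 1`** at every A2 pair `(W, p)` with
`p ∤ [W(ℚ) : W(ℚ) ∩ W⁰(ℚ_ℓ)]` for all `ℓ` (kit j258343: 1 955 of 2 797 class-pairs) admitting a degree-`p`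
`ℚ`-isogeny `φ : W → W'` onto a globally minimal `W'` with (red). Inputs: W16, BMS 1.7, GV 1.3, Greenberg 5.10,
Mazur–Tate σ, modularity, GZK, MT83 (3.4.3), DD15 Lemma 24. [cite: BalakrishnanMullerStein2015, Thm. 1.7]
[cite: GreenbergVatsal2000, Thm. (1.3)] [cite: GreenbergLNM1716, Prop. 5.10 (PDF p. 147)]
[cite: Wuthrich2014, Thm. 16 (p. 393)] [cite: MazurTate1983Biext, §3.4 (3.4.3)]
[cite: DokchitserDokchitser2015LocalInvariants, §6 Lemma 24 (arXiv numbering)] -/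
theorem not_analyticLambdaEq_one_of_typeBRankOne_of_isogeny_of_red
    (hW16 : Wuthrich2014.charIdeal_dvd_padicLFunction) (hS : Schneider1985_order_charGenerator_odd)
    (hGV : GreenbergVatsal2000.thm13_charIdeal_eq_of_gvPar)
    (h510 : prop510_isTorsion_hasUnitContent_of_gvPar) (hMT : mazur_tate_sigma_exists_odd)
    (hmodP : nonempty_modularParametrizationData) (hGZK : rank_eq_analyticRank_of_analyticRank_le_one)
    (hadjF : Literature.NumberTheory.EllipticCurves.canonicalPAdicHeight_isogeny_adjoint)
    (hNer : Literature.NumberTheory.EllipticCurves.isogeny_pointHom_maps_nonsingularReductionSubgroupAt) (hB : X1.TypeBRankOne W p)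
    (hidx : ∀ (ℓ : ℕ) [Fact ℓ.Prime], ¬ p ∣ (W.nonsingularReductionSubgroupAt ℓ).index)
    (φ : Isogeny W W') (hdeg : φ.degree = p) {f : W.toAffine.Point →+ W'.toAffine.Point}
    (hf : ∀ P : W.toAffine.Point, W'.toGeomPoints (f P) = φ (W.toGeomPoints P))
    (hred : ∀ R : W.toAffine.Point, p • R ∈ W.kernelOfReductionAt p → f R ∈ W'.kernelOfReductionAt p) :
    ¬ AnalyticLambdaEq W p 1 :=
  not_analyticLambdaEq_one_of_typeBRankOne_of_isogeny hW16 hS hGV h510 hMT hmodP hGZK hadjF hB hidx φ hdeg hf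
    hred (fun ℓ _ R hR ↦ hNer W W' φ (hdeg ▸ Fact.out) f hf ℓ R hR)

/-- **T-λ3, counted form, with (comp) from print: every certified `λ_an = n` at such an A2 pair has `n ≥ 3`**
(λ-parity on rank one excludes `λ_an = 2`). [cite: GreenbergVatsal2000, Thm. (1.3)]
[cite: MazurTateTeitelbaum1986Invent, §I.17–I.18] [cite: MazurTate1983Biext, §3.4 (3.4.3)]
[cite: BalakrishnanMullerStein2015, Thm. 1.7]
[cite: DokchitserDokchitser2015LocalInvariants, §6 Lemma 24 (arXiv numbering)] -/
theorem three_le_of_analyticLambdaEq_of_typeBRankOne_of_isogeny_of_red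
    (hW16 : Wuthrich2014.charIdeal_dvd_padicLFunction) (hS : Schneider1985_order_charGenerator_odd)
    (hGV : GreenbergVatsal2000.thm13_charIdeal_eq_of_gvPar)
    (h510 : prop510_isTorsion_hasUnitContent_of_gvPar) (hMT : mazur_tate_sigma_exists_odd)
    (hmodP : nonempty_modularParametrizationData) (hGZK : rank_eq_analyticRank_of_analyticRank_le_one)
    (hadjF : Literature.NumberTheory.EllipticCurves.canonicalPAdicHeight_isogeny_adjoint)
    (hNer : Literature.NumberTheory.EllipticCurves.isogeny_pointHom_maps_nonsingularReductionSubgroupAt) (hB : X1.TypeBRankOne W p)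
    (hidx : ∀ (ℓ : ℕ) [Fact ℓ.Prime], ¬ p ∣ (W.nonsingularReductionSubgroupAt ℓ).index)
    (φ : Isogeny W W') (hdeg : φ.degree = p) {f : W.toAffine.Point →+ W'.toAffine.Point}
    (hf : ∀ P : W.toAffine.Point, W'.toGeomPoints (f P) = φ (W.toGeomPoints P))
    (hred : ∀ R : W.toAffine.Point, p • R ∈ W.kernelOfReductionAt p → f R ∈ W'.kernelOfReductionAt p)
    {n : ℕ} (hn : AnalyticLambdaEq W p n) : 3 ≤ n :=
  three_le_of_analyticLambdaEq_of_typeBRankOne_of_isogeny hW16 hS hGV h510 hMT hmodP hGZK hadjF hB hidx φ hdeg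
    hf hred (fun ℓ _ R hR ↦ hNer W W' φ (hdeg ▸ Fact.out) f hf ℓ R hR) hn

end Summit.BirchSwinnertonDyer.BirchSwinnertonDyer.Theorems.DegenerateLocusA2HeightIntegralityNeron

end
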